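import Literature.IUT.HodgeTheaters.PMBaseModels

/-!
# [IUTchI] §6, Definition 6.4: base-`Θ^±`-bridges, base-`Θ^{ell}`-bridges, base-`Θ^{±ell}`-Hodge theaters

Mochizuki, *Inter-universal Teichmüller theory I*, §6, Definition 6.4 (i)–(iii) pp. 162–163, kurims
manuscript (May 2020) ([IUTchI] Def 6.4 pp.162-163) [claim: Mochizuki2012, status: disputed], over the base interface
`PMBaseKit` and the model bridges of Examples 6.2, 6.3 (`PMBaseModels.lean`):

* (i) a `𝒟-Θ^±`-bridge `†φ^{Θ±}_± : †𝔇_T → †𝔇_≻` (`DThetaPMBridge`): `T` an `𝔽_l^±`-group, `†𝔇_T` a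
  capsule of `𝒟`-prime-strips indexed by `T`, `†𝔇_≻` a `𝒟`-prime-strip, and a poly-morphism "such
  that there exist isomorphisms `𝔇_≻ ⥲ †𝔇_≻`, `𝔇_± ⥲ †𝔇_T` — where we require that the bijection of
  index sets `𝔽_l ⥲ T` induced by the second isomorphism determine an isomorphism of `𝔽_l^±`-groups —
  conjugation by which maps `φ^{Θ±}_± ↦ †φ^{Θ±}_±`"; the capsules `†𝔇_{|T|}`, `†𝔇_{T^⋇}`; isomorphisms
  of `𝒟-Θ^±`-bridges;
* (ii) a `𝒟-Θ^{ell}`-bridge `†φ^{Θell}_± : †𝔇_T → †𝒟^{⊚±}` (`DThetaEllBridge`), `T` an `𝔽_l^±`-torsor,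
  locally the conjugate of the model of Example 6.3; isomorphisms of `𝒟-Θ^{ell}`-bridges (the
  global component "an `Aut_csp(†𝒟^{⊚±})`-orbit of isomorphisms");
* (iii) a `𝒟-Θ^{±ell}`-Hodge theater `†ℋ𝒯^{𝒟-Θ±ell} = (†𝔇_≻ ← †𝔇_T → †𝒟^{⊚±})` (`DThetaPMEllHT`) with its
  two underlying bridges, and isomorphisms of such.

"Compatible with `†φ`, `‡φ`" for a pair of poly-morphisms is rendered, as in §0, by equality of the
two composite poly-morphisms (sets of composites). l^±-capsules `†𝔇_{|T|}` are formed with a chosen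
representative of each class `{t, −t}` ("each constituent `𝒟`-prime-strip of `†𝔇_{|T|}` is only
well-defined up to a positive automorphism, but this indeterminacy will not affect applications",
Def 6.4 (i) p. 162).
-/

namespace Literature.IUT.HodgeTheaters

open CategoryTheory

universe u

namespace PMBaseKit

variable {l : ℕ} (K : PMBaseKit.{u} l)

/-! ### Def 6.4 (i): `𝒟-Θ^±`-bridges -/

/-- A **base-`Θ^±`-bridge**, or `𝒟-Θ^±`-bridge, `†φ^{Θ±}_± : †𝔇_T → †𝔇_≻` ([IUTchI] Def 6.4 (i) p. 162):
"`†𝔇_≻` is a `𝒟`-prime-strip; `T` is an `𝔽_l^±`-group; `†𝔇_T = {†𝔇_t}_{t∈T}` is a capsule of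
`𝒟`-prime-strips, indexed by `T`" and a poly-morphism (a collection of poly-morphisms
`†φ^{Θ±}_t : †𝔇_t → †𝔇_≻`) "such that there exist isomorphisms `𝔇_≻ ⥲ †𝔇_≻`, `𝔇_± ⥲ †𝔇_T` — where we
require that the bijection of index sets `𝔽_l ⥲ T` induced by the second isomorphism determine an
isomorphism of `𝔽_l^±`-groups — conjugation by which maps `φ^{Θ±}_± ↦ †φ^{Θ±}_±`" (model: Example 6.2
(i)). ([IUTchI] Def 6.4 (i) p.162) [claim: Mochizuki2012, status: disputed] -/
structure DThetaPMBridge where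
  /-- the index set `T` -/
  T : Type
  /-- `T` is finite -/
  [fintypeT : Fintype T]
  /-- "`T` is an `𝔽_l^±`-group" -/
  grpT : FlPMGroup l T
  /-- the capsule `†𝔇_T = {†𝔇_t}_{t ∈ T}` of `𝒟`-prime-strips -/
  capsule : K.DCapsule T
  /-- the `𝒟`-prime-strip `†𝔇_≻` -/
  codomain : K.DStrip
  /-- the poly-morphisms `†φ^{Θ±}_t : †𝔇_t → †𝔇_≻`, `t ∈ T` (poly-isomorphisms of `𝒟`-prime-strips) -/
  poly : ∀ t, Set ((capsule t).Iso codomain)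
  /-- "there exist isomorphisms `𝔇_≻ ⥲ †𝔇_≻`, `𝔇_± ⥲ †𝔇_T` [inducing an isomorphism of `𝔽_l^±`-groups
  `𝔽_l ⥲ T` on index sets] conjugation by which maps `φ^{Θ±}_± ↦ †φ^{Θ±}_±`" -/
  exists_model : ∃ (ι : ZMod l ≃ T) (_ : ∀ e ∈ grpT.charts, ι.trans e ∈ (FlPMGroup.tautological l).charts)
    (α : ∀ z, (DStrip.model K).Iso (capsule (ι z))) (β : (DStrip.model K).Iso codomain),
    ∀ z, poly (ι z) = DStrip.polyConj (α z) β (Ex62.poly K z)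

attribute [instance] DThetaPMBridge.fintypeT

namespace DThetaPMBridge

variable {K} (B : K.DThetaPMBridge)

/-- `†𝔇_{|T|}`: "the `l^±`-capsule obtained from the `l`-capsule `†𝔇_T` by forming the quotient `|T|` of
the index set `T` … by the action of `{±1}` and identifying the components of the capsule `†𝔇_T`
indexed by the elements in the fibers of the quotient `T ↠ |T|` via the constituent poly-morphisms of
`†φ^{Θ±}_±` [so each constituent `𝒟`-prime-strip of `†𝔇_{|T|}` is only well-defined up to a positive
automorphism …]" ([IUTchI] Def 6.4 (i) p. 162); here: the component of a chosen representative.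
([IUTchI] Def 6.4 (i) p.162) [claim: Mochizuki2012, status: disputed] -/
noncomputable def absCapsule : K.DCapsule B.grpT.Abs := fun q => B.capsule (Quotient.out q)

/-- `†𝔇_{T^⋇}`: "the `l^⋇`-capsule determined by the subset `T^⋇ := |T| \ {0}` of nonzero elements of
`|T|`" ([IUTchI] Def 6.4 (i) p. 162). ([IUTchI] Def 6.4 (i) p.162) [claim: Mochizuki2012, status: disputed] -/
noncomputable def starCapsule : K.DCapsule B.grpT.AbsStar := fun q => B.absCapsule q.1

/-- An **isomorphism of `𝒟-Θ^±`-bridges** ([IUTchI] Def 6.4 (i) p. 162): "a pair of poly-morphisms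
`†𝔇_T ⥲ ‡𝔇_{T'}`; `†𝔇_≻ ⥲ ‡𝔇_≻` — where `†𝔇_T ⥲ ‡𝔇_{T'}` is a capsule-`+`-full poly-isomorphism whose
induced morphism on index sets `T ⥲ T'` is an isomorphism of `𝔽_l^±`-groups; `†𝔇_≻ ⥲ ‡𝔇_≻` is a `+`-full
poly-isomorphism — which are compatible with `†φ^{Θ±}_±`, `‡φ^{Θ±}_±`".
([IUTchI] Def 6.4 (i) p.162) [claim: Mochizuki2012, status: disputed] -/
structure Iso (B₁ B₂ : K.DThetaPMBridge) where
  /-- the induced bijection of index sets `T ⥲ T'` … -/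
  indexEquiv : B₁.T ≃ B₂.T
  /-- … "is an isomorphism of `𝔽_l^±`-groups" (charts pull back to charts) -/
  indexEquiv_charts : ∀ e ∈ B₂.grpT.charts, indexEquiv.trans e ∈ B₁.grpT.charts
  /-- the constituents `†𝔇_t ⥲ ‡𝔇_{ι t}` of the capsule-`+`-full poly-isomorphism ([IUTchI] Def 6.1
  (iv) p. 157 "collections of `+`-full poly-isomorphisms … relative to some injection `ι`") -/
  capsPoly : ∀ t, Set ((B₁.capsule t).Iso (B₂.capsule (indexEquiv t)))
  /-- each constituent is a `+`-full poly-isomorphism -/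
  capsPoly_plusFull : ∀ t, DStrip.IsPlusFullPolyIso (capsPoly t)
  /-- the `+`-full poly-isomorphism `†𝔇_≻ ⥲ ‡𝔇_≻` -/
  codPoly : Set (B₁.codomain.Iso B₂.codomain)
  /-- it is `+`-full -/
  codPoly_plusFull : DStrip.IsPlusFullPolyIso codPoly
  /-- compatibility with `†φ^{Θ±}_±`, `‡φ^{Θ±}_±`: the two composite poly-morphisms `†𝔇_t → ‡𝔇_≻` agree -/
  compat : ∀ t, DStrip.polyComp (capsPoly t) (B₂.poly (indexEquiv t)) = DStrip.polyComp (B₁.poly t) codPoly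

/-- "There is an evident notion of composition of morphisms of `𝒟-Θ^±`-bridges" ([IUTchI] Def 6.4 (i)
p. 162): the composite index bijection (compatibility of the composite poly-isomorphisms:
`Iso.compClosed`, PROVED). ([IUTchI] Def 6.4 (i) p.162) [claim: Mochizuki2012, status: disputed] -/
def Iso.compIndexEquiv {B₁ B₂ B₃ : K.DThetaPMBridge} (f : Iso B₁ B₂) (g : Iso B₂ B₃) : B₁.T ≃ B₃.T :=
  f.indexEquiv.trans g.indexEquiv

/-- Composition of isomorphisms of `𝒟`-prime-strips is associative. ([IUTchI] §0 p.33) [claim: Mochizuki2012, status: disputed] -/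
theorem _root_.Literature.IUT.HodgeTheaters.PMBaseKit.DStrip.Iso.trans_assoc {D₁ D₂ D₃ D₄ : K.DStrip}
    (f : D₁.Iso D₂) (g : D₂.Iso D₃) (h : D₃.Iso D₄) : (f.trans g).trans h = f.trans (g.trans h) := by
  funext v
  simp [DStrip.Iso.trans]

/-- Composition of poly-isomorphisms of `𝒟`-prime-strips is associative ([IUTchI] §0 p. 33: composites
of composites). PROVED. ([IUTchI] §0 p.33) [claim: Mochizuki2012, status: disputed] -/
theorem _root_.Literature.IUT.HodgeTheaters.PMBaseKit.DStrip.polyComp_assoc {D₁ D₂ D₃ D₄ : K.DStrip}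
    (P : Set (D₁.Iso D₂)) (Q : Set (D₂.Iso D₃)) (R : Set (D₃.Iso D₄)) :
    DStrip.polyComp (DStrip.polyComp P Q) R = DStrip.polyComp P (DStrip.polyComp Q R) := by
  ext h
  simp only [DStrip.polyComp, Set.mem_setOf_eq]
  constructor
  · rintro ⟨fg, ⟨f, hf, g, hg, rfl⟩, r, hr, rfl⟩
    exact ⟨f, hf, g.trans r, ⟨g, hg, r, hr, rfl⟩, DStrip.Iso.trans_assoc f g r⟩
  · rintro ⟨f, hf, gr, ⟨g, hg, r, hr, rfl⟩, rfl⟩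
    exact ⟨f.trans g, ⟨f, hf, g, hg, rfl⟩, r, hr, (DStrip.Iso.trans_assoc f g r).symm⟩

/-- The printed "evident notion of composition": composites of the constituent poly-isomorphisms of
two composable isomorphisms of `𝒟-Θ^±`-bridges again satisfy the compatibility condition
([IUTchI] Def 6.4 (i) p. 162). PROVED (associativity of composition of poly-morphisms).
([IUTchI] Def 6.4 (i) p.162) [claim: Mochizuki2012, status: disputed] -/
theorem Iso.compClosed {B₁ B₂ B₃ : K.DThetaPMBridge} (f : Iso B₁ B₂) (g : Iso B₂ B₃) (t : B₁.T) :
    DStrip.polyComp (DStrip.polyComp (f.capsPoly t) (g.capsPoly (f.indexEquiv t)))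
        (B₃.poly (g.indexEquiv (f.indexEquiv t))) =
      DStrip.polyComp (B₁.poly t) (DStrip.polyComp f.codPoly g.codPoly) := by
  rw [DStrip.polyComp_assoc, g.compat, ← DStrip.polyComp_assoc, f.compat, DStrip.polyComp_assoc]

end DThetaPMBridge

/-- The model `𝒟-Θ^±`-bridge `φ^{Θ±}_± : 𝔇_± → 𝔇_≻` of [IUTchI] Example 6.2 (i) p. 160 is a `𝒟-Θ^±`-bridge.
([IUTchI] Ex 6.2 (i) p.160) [claim: Mochizuki2012, status: disputed] -/
def Ex62.bridge [NeZero l] : K.DThetaPMBridge where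
  T := ZMod l
  grpT := FlPMGroup.tautological l
  capsule := Ex62.capsule K
  codomain := Ex62.codomain K
  poly := Ex62.poly K
  exists_model := by
    refine ⟨Equiv.refl _, fun e he => by simpa using he, fun _ => DStrip.Iso.refl (DStrip.model K),
      DStrip.Iso.refl (DStrip.model K), fun z => ?_⟩
    have hconj : ∀ f : (DStrip.model K).Iso (DStrip.model K),
        ((DStrip.Iso.refl (DStrip.model K)).symm.trans f).trans (DStrip.Iso.refl (DStrip.model K)) = f :=
      fun f => funext fun v => by simp [DStrip.Iso.trans, DStrip.Iso.symm, DStrip.Iso.refl]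
    ext h
    constructor
    · intro hh
      exact ⟨h, hh, (hconj h).symm⟩
    · rintro ⟨f, hf, rfl⟩
      rw [hconj f]
      exact hf

/-! ### Def 6.4 (ii): `𝒟-Θ^{ell}`-bridges -/

/-- Conjugating a poly-morphism `𝔇 → 𝒟^{⊚±}` at `v` by an isomorphism of `𝒟`-prime-strips `α : 𝔇 ⥲ 𝔇'`
and an isomorphism `β : 𝒟^{⊚±} ⥲ †𝒟^{⊚±}`: `{β ∘ f ∘ α⁻¹}` ([IUTchI] Def 6.4 (ii) p. 163 "conjugation by
which maps `φ^{Θell}_± ↦ †φ^{Θell}_±`"). ([IUTchI] Def 6.4 (ii) p.163) [claim: Mochizuki2012, status: disputed] -/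
def ellConj {D D' : K.DStrip} {G G' : K.Glob} (α : D.Iso D') (β : G ≅ G') (v : K.V)
    (P : Set (D.obj v ⟶ (K.atV v).obj G)) : Set (D'.obj v ⟶ (K.atV v).obj G') :=
  {h | ∃ f ∈ P, h = (α v).inv ≫ f ≫ (K.atV v).map β.hom}

/-- A **base-`Θ^{ell}`-bridge**, or `𝒟-Θ^{ell}`-bridge, `†φ^{Θell}_± : †𝔇_T → †𝒟^{⊚±}` ([IUTchI] Def 6.4 (ii)
pp. 162–163): "`†𝒟^{⊚±}` is a category equivalent to `𝒟^{⊚±}`; `T` is an `𝔽_l^±`-torsor;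
`†𝔇_T = {†𝔇_t}_{t∈T}` is a capsule of `𝒟`-prime-strips, indexed by `T`" and a poly-morphism "such that
there exist isomorphisms `𝒟^{⊚±} ⥲ †𝒟^{⊚±}`, `𝔇_± ⥲ †𝔇_T` — where we require that the bijection of index
sets `𝔽_l ⥲ T` induced by the second isomorphism determine an isomorphism of `𝔽_l^±`-torsors —
conjugation by which maps `φ^{Θell}_± ↦ †φ^{Θell}_±`" (model: Example 6.3 (i)).
([IUTchI] Def 6.4 (ii) p.162) [claim: Mochizuki2012, status: disputed] -/
structure DThetaEllBridge where
  /-- the index set `T` -/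
  T : Type
  /-- `T` is finite -/
  [fintypeT : Fintype T]
  /-- "`T` is an `𝔽_l^±`-torsor" -/
  torT : FlPMTorsor l T
  /-- the capsule `†𝔇_T` of `𝒟`-prime-strips -/
  capsule : K.DCapsule T
  /-- the global object `†𝒟^{⊚±}` -/
  glob : K.Glob
  /-- the poly-morphisms `†φ^{Θell}_{v_t} : †𝒟_{v_t} → †𝒟^{⊚±}`, `t ∈ T`, `v ∈ 𝕍` -/
  poly : ∀ t v, Set ((capsule t).obj v ⟶ (K.atV v).obj glob)
  /-- "there exist isomorphisms `𝒟^{⊚±} ⥲ †𝒟^{⊚±}`, `𝔇_± ⥲ †𝔇_T` [inducing an isomorphism of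
  `𝔽_l^±`-torsors `𝔽_l ⥲ T` on index sets] conjugation by which maps `φ^{Θell}_± ↦ †φ^{Θell}_±`" -/
  exists_model : ∃ (ι : ZMod l ≃ T) (_ : ∀ e ∈ torT.charts, ι.trans e ∈ (FlPMTorsor.tautological l).charts)
    (α : ∀ z, (DStrip.model K).Iso (capsule (ι z))) (β : K.gModel ≅ glob),
    ∀ z v, poly (ι z) v = K.ellConj (α z) β v (Ex63.poly K z v)

attribute [instance] DThetaEllBridge.fintypeT

namespace DThetaEllBridge

variable {K}

/-- An isomorphism `β : 𝒟^{⊚±} ⥲ †𝒟^{⊚±}` EXHIBITS the `𝒟-Θ^{ell}`-bridge if, together with isomorphisms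
`𝔇_± ⥲ †𝔇_T`, "conjugation by [it] maps `φ^{Θell}_± ↦ †φ^{Θell}_±`" ([IUTchI] Def 6.4 (ii) p. 163); along
such a `β` the `𝔽_l^±`-torsor structure of `LabCusp^±(𝒟^{⊚±})` is transported to `LabCusp^±(†𝒟^{⊚±})`
(`PMBaseKit.gLabTOf`). ([IUTchI] Def 6.4 (ii) p.163) [claim: Mochizuki2012, status: disputed] -/
def Exhibits (B : K.DThetaEllBridge) (β : K.gModel ≅ B.glob) : Prop :=
  ∃ (ι : ZMod l ≃ B.T) (_ : ∀ e ∈ B.torT.charts, ι.trans e ∈ (FlPMTorsor.tautological l).charts)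
    (α : ∀ z, (DStrip.model K).Iso (B.capsule (ι z))),
    ∀ z v, B.poly (ι z) v = K.ellConj (α z) β v (Ex63.poly K z v)

/-- Every `𝒟-Θ^{ell}`-bridge is exhibited by some isomorphism (its defining datum).
([IUTchI] Def 6.4 (ii) p.163) [claim: Mochizuki2012, status: disputed] -/
theorem exists_exhibits (B : K.DThetaEllBridge) : ∃ β, B.Exhibits β := by
  obtain ⟨ι, hι, α, β, h⟩ := B.exists_model
  exact ⟨β, ι, hι, α, h⟩

/-- An **isomorphism of `𝒟-Θ^{ell}`-bridges** ([IUTchI] Def 6.4 (ii) p. 163): "a pair of poly-morphisms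
`†𝔇_T ⥲ ‡𝔇_{T'}`; `†𝒟^{⊚±} ⥲ ‡𝒟^{⊚±}` — where `†𝔇_T ⥲ ‡𝔇_{T'}` is a capsule-`+`-full poly-isomorphism whose
induced morphism on index sets `T ⥲ T'` is an isomorphism of `𝔽_l^±`-torsors; `†𝒟^{⊚±} → ‡𝒟^{⊚±}` is a
poly-morphism which is an `Aut_csp(†𝒟^{⊚±})`- [or, equivalently, `Aut_csp(‡𝒟^{⊚±})`-] orbit of
isomorphisms — which are compatible with `†φ^{Θell}_±`, `‡φ^{Θell}_±`".
([IUTchI] Def 6.4 (ii) p.163) [claim: Mochizuki2012, status: disputed] -/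
structure Iso (B₁ B₂ : K.DThetaEllBridge) where
  /-- the induced bijection of index sets … -/
  indexEquiv : B₁.T ≃ B₂.T
  /-- … "is an isomorphism of `𝔽_l^±`-torsors" -/
  indexEquiv_charts : ∀ e ∈ B₂.torT.charts, indexEquiv.trans e ∈ B₁.torT.charts
  /-- the constituents of the capsule-`+`-full poly-isomorphism -/
  capsPoly : ∀ t, Set ((B₁.capsule t).Iso (B₂.capsule (indexEquiv t)))
  /-- each constituent is `+`-full -/
  capsPoly_plusFull : ∀ t, DStrip.IsPlusFullPolyIso (capsPoly t)
  /-- the poly-isomorphism `†𝒟^{⊚±} ⥲ ‡𝒟^{⊚±}` … -/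
  globPoly : Set (B₁.glob ≅ B₂.glob)
  /-- … "an `Aut_csp(‡𝒟^{⊚±})`-orbit of isomorphisms" -/
  globPoly_orbit : ∃ φ : B₁.glob ≅ B₂.glob, globPoly = {ψ | ∃ c ∈ K.autCsp B₂.glob, ψ = φ ≪≫ c}
  /-- compatibility with `†φ^{Θell}_±`, `‡φ^{Θell}_±` at every `t`, `v` -/
  compat : ∀ t v,
    {h | ∃ p ∈ capsPoly t, ∃ g ∈ B₂.poly (indexEquiv t) v, h = (p v).hom ≫ g} =
      {h | ∃ f ∈ B₁.poly t v, ∃ q ∈ globPoly, h = f ≫ (K.atV v).map (q : B₁.glob ≅ B₂.glob).hom}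

end DThetaEllBridge

/-- Conjugating by identities does nothing: `ellConj (refl) (refl) P = P`.
([IUTchI] Def 6.4 (ii) p.163) [claim: Mochizuki2012, status: disputed] -/
theorem ellConj_refl {D : K.DStrip} {G : K.Glob} (v : K.V) (P : Set (D.obj v ⟶ (K.atV v).obj G)) :
    K.ellConj (DStrip.Iso.refl D) (Iso.refl G) v P = P := by
  ext h
  simp [ellConj, DStrip.Iso.refl]

/-- The model `𝒟-Θ^{ell}`-bridge `φ^{Θell}_± : 𝔇_± → 𝒟^{⊚±}` of [IUTchI] Example 6.3 (i) p. 161 is a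
`𝒟-Θ^{ell}`-bridge (non-vacuity of Def 6.4 (ii) relative to the interface). PROVED.
([IUTchI] Ex 6.3 (i) p.161) [claim: Mochizuki2012, status: disputed] -/
def Ex63.bridge [NeZero l] : K.DThetaEllBridge where
  T := ZMod l
  torT := FlPMTorsor.tautological l
  capsule := Ex62.capsule K
  glob := K.gModel
  poly := Ex63.poly K
  exists_model := by
    refine ⟨Equiv.refl _, fun e he => by simpa using he, fun _ => DStrip.Iso.refl (DStrip.model K),
      Iso.refl _, fun z v => ?_⟩
    exact (K.ellConj_refl (D := DStrip.model K) (G := K.gModel) v (Ex63.poly K z v)).symm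

/-! ### Def 6.4 (iii): `𝒟-Θ^{±ell}`-Hodge theaters -/

/-- A **base-`Θ^{±ell}`-Hodge theater**, or `𝒟-Θ^{±ell}`-Hodge theater,
`†ℋ𝒯^{𝒟-Θ±ell} = (†𝔇_≻ ⟵ †𝔇_T ⟶ †𝒟^{⊚±})` ([IUTchI] Def 6.4 (iii) p. 163): "`T` is an `𝔽_l^±`-group;
`†φ^{Θ±}_±` is a `𝒟-Θ^±`-bridge; `†φ^{Θell}_±` is a `𝒟-Θ^{ell}`-bridge [relative to the `𝔽_l^±`-torsor
structure determined by the `𝔽_l^±`-group structure on `T`] — such that there exist isomorphisms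
`𝔇_≻ ⥲ †𝔇_≻`; `𝔇_± ⥲ †𝔇_T`; `𝒟^{⊚±} ⥲ †𝒟^{⊚±}` conjugation by which maps `φ^{Θ±}_± ↦ †φ^{Θ±}_±`,
`φ^{Θell}_± ↦ †φ^{Θell}_±`" (the two bridges share `T` and the capsule `†𝔇_T`).
([IUTchI] Def 6.4 (iii) p.163) [claim: Mochizuki2012, status: disputed] -/
structure DThetaPMEllHT where
  /-- the index set `T` -/
  T : Type
  /-- `T` is finite -/
  [fintypeT : Fintype T]
  /-- "`T` is an `𝔽_l^±`-group" -/
  grpT : FlPMGroup l T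
  /-- the shared capsule `†𝔇_T` -/
  capsule : K.DCapsule T
  /-- `†𝔇_≻` -/
  codomain : K.DStrip
  /-- the `𝒟-Θ^±`-bridge poly-morphisms `†φ^{Θ±}_t` -/
  polyPM : ∀ t, Set ((capsule t).Iso codomain)
  /-- `†𝒟^{⊚±}` -/
  glob : K.Glob
  /-- the `𝒟-Θ^{ell}`-bridge poly-morphisms `†φ^{Θell}_{v_t}` -/
  polyEll : ∀ t v, Set ((capsule t).obj v ⟶ (K.atV v).obj glob)
  /-- simultaneous model isomorphisms `𝔇_≻ ⥲ †𝔇_≻`, `𝔇_± ⥲ †𝔇_T` (an isomorphism of `𝔽_l^±`-groups on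
  indices), `𝒟^{⊚±} ⥲ †𝒟^{⊚±}` conjugating `φ^{Θ±}_± ↦ †φ^{Θ±}_±` and `φ^{Θell}_± ↦ †φ^{Θell}_±` -/
  exists_model : ∃ (ι : ZMod l ≃ T) (_ : ∀ e ∈ grpT.charts, ι.trans e ∈ (FlPMGroup.tautological l).charts)
    (α : ∀ z, (DStrip.model K).Iso (capsule (ι z))) (β : (DStrip.model K).Iso codomain)
    (γ : K.gModel ≅ glob),
    (∀ z, polyPM (ι z) = DStrip.polyConj (α z) β (Ex62.poly K z)) ∧
      ∀ z v, polyEll (ι z) v = K.ellConj (α z) γ v (Ex63.poly K z v)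

attribute [instance] DThetaPMEllHT.fintypeT

/-- The model `𝒟-Θ^{±ell}`-Hodge theater `(𝔇_≻ ⟵ 𝔇_± ⟶ 𝒟^{⊚±})` assembled from Examples 6.2 (i) and 6.3 (i)
([IUTchI] Def 6.4 (iii) p. 163; Fig. 6.1) — non-vacuity of Def 6.4 (iii) relative to the interface.
PROVED. ([IUTchI] Def 6.4 (iii) p.163) [claim: Mochizuki2012, status: disputed] -/
def Ex62.ht [NeZero l] : K.DThetaPMEllHT where
  T := ZMod l
  grpT := FlPMGroup.tautological l
  capsule := Ex62.capsule K
  codomain := Ex62.codomain K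
  polyPM := Ex62.poly K
  glob := K.gModel
  polyEll := Ex63.poly K
  exists_model := by
    obtain ⟨ι, hι, α, β, h⟩ := (Ex62.bridge K).exists_model
    refine ⟨Equiv.refl _, fun e he => by simpa using he, fun _ => DStrip.Iso.refl (DStrip.model K),
      DStrip.Iso.refl (DStrip.model K), Iso.refl _, fun z => ?_, fun z v => ?_⟩
    · have hconj : ∀ f : (DStrip.model K).Iso (DStrip.model K),
          ((DStrip.Iso.refl (DStrip.model K)).symm.trans f).trans (DStrip.Iso.refl (DStrip.model K)) = f :=
        fun f => funext fun v => by simp [DStrip.Iso.trans, DStrip.Iso.symm, DStrip.Iso.refl]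
      ext f
      constructor
      · intro hf; exact ⟨f, hf, (hconj f).symm⟩
      · rintro ⟨g, hg, rfl⟩; rw [hconj g]; exact hg
    · exact (K.ellConj_refl (D := DStrip.model K) (G := K.gModel) v (Ex63.poly K z v)).symm

namespace DThetaPMEllHT

variable {K} (H : K.DThetaPMEllHT)

/-- The underlying `𝒟-Θ^±`-bridge of a `𝒟-Θ^{±ell}`-Hodge theater ([IUTchI] Def 6.4 (iii) p. 163).
([IUTchI] Def 6.4 (iii) p.163) [claim: Mochizuki2012, status: disputed] -/
def pmBridge : K.DThetaPMBridge where
  T := H.T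
  grpT := H.grpT
  capsule := H.capsule
  codomain := H.codomain
  poly := H.polyPM
  exists_model := by
    obtain ⟨ι, hι, α, β, γ, h1, -⟩ := H.exists_model
    exact ⟨ι, hι, α, β, h1⟩

/-- An isomorphism of `𝔽_l^±`-groups `𝔽_l ⥲ T` is an isomorphism of the induced `𝔽_l^±`-torsors.
([IUTchI] Def 6.4 (iii) p.163) [claim: Mochizuki2012, status: disputed] -/
theorem indexEquiv_torsor_charts {T : Type} (S : FlPMGroup l T) (ι : ZMod l ≃ T)
    (hι : ∀ e ∈ S.charts, ι.trans e ∈ (FlPMGroup.tautological l).charts) :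
    ∀ e ∈ S.toTorsor.charts, ι.trans e ∈ (FlPMTorsor.tautological l).charts := by
  rintro f ⟨e, he, g, rfl⟩
  obtain ⟨ε, hε⟩ := hι e he
  refine ⟨g * FlPM.mk 0 ε, ?_⟩
  ext z
  have hz := congrArg (fun σ => σ z) hε
  simp only [Equiv.trans_apply, signPerm_apply] at hz
  simp only [FlPM.toPerm_apply, Equiv.trans_apply, mul_smul, FlPM.mk_smul, add_zero, hz]

/-- The underlying `𝒟-Θ^{ell}`-bridge of a `𝒟-Θ^{±ell}`-Hodge theater, "relative to the `𝔽_l^±`-torsor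
structure determined by the `𝔽_l^±`-group structure on `T`" ([IUTchI] Def 6.4 (iii) p. 163).
([IUTchI] Def 6.4 (iii) p.163) [claim: Mochizuki2012, status: disputed] -/
def ellBridge : K.DThetaEllBridge where
  T := H.T
  torT := H.grpT.toTorsor
  capsule := H.capsule
  glob := H.glob
  poly := H.polyEll
  exists_model := by
    obtain ⟨ι, hι, α, β, γ, -, h2⟩ := H.exists_model
    exact ⟨ι, indexEquiv_torsor_charts H.grpT ι hι, α, γ, h2⟩

/-- An **isomorphism of `𝒟-Θ^{±ell}`-Hodge theaters**: "a pair of morphisms between the respective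
associated `𝒟-Θ^±`- and `𝒟-Θ^{ell}`-bridges that are compatible with one another in the sense that they
induce the same poly-isomorphism between the respective capsules of `𝒟`-prime-strips" ([IUTchI] Def
6.4 (iii) p. 163). ([IUTchI] Def 6.4 (iii) p.163) [claim: Mochizuki2012, status: disputed] -/
structure Iso (H₁ H₂ : K.DThetaPMEllHT) where
  /-- the isomorphism of underlying `𝒟-Θ^±`-bridges -/
  pmIso : DThetaPMBridge.Iso H₁.pmBridge H₂.pmBridge
  /-- the isomorphism of underlying `𝒟-Θ^{ell}`-bridges -/
  ellIso : DThetaEllBridge.Iso H₁.ellBridge H₂.ellBridge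
  /-- same bijection of index sets -/
  index_eq : ∀ t : H₁.T, (pmIso.indexEquiv t : H₂.T) = ellIso.indexEquiv t
  /-- same poly-isomorphism between the capsules -/
  caps_eq : ∀ t : H₁.T, ∀ p : (H₁.capsule t).Iso (H₂.capsule (pmIso.indexEquiv t)),
    p ∈ pmIso.capsPoly t ↔ (fun v => p v ≪≫ eqToIso (by rw [index_eq t]; rfl)) ∈ ellIso.capsPoly t

end DThetaPMEllHT

end PMBaseKit

end Literature.IUT.HodgeTheaters
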